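import Summits.ABC.IUTFork.Conditional.AbcOfSHwBadMShallowReyssatHigher
import Summits.ABC.IUTFork.Cor312GenuineKTwistLowerBoundUnconditional
import HarnessLib

/-!
# Branch C / R-W, M line — ROW «W:M-SHALLOW-REYSSAT-17-19», UNIFORM upgrade: the Reyssat datum `λ = 2/23⁵` is M-SHALLOW at EVERY member of EVERY
# genuine Θ-volume datum for EVERY prime `l ≤ 19` and EVERY prime `l ≥ 85`, `l ≠ 109` — one theorem for all 15 tabulated Reyssat M rows

PROOF-ONLY file (no `def`, no new `Prop`, no instance, no notation; nothing re-typed) of the abc-iut cell (D-0079 R-W numerics crew seat abc-iut-W-num-4,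
gen 4; abc-iut-plan RULING C-R73 (2)). Sequel of this seat's `AbcOfSHwBadMShallowReyssatHigher` (p484988, `l ∈ {17, 19}`) and of abc-iut-C-cert-3's
`AbcOfSHwBadMShallowReyssat` (p482049, `l = 13`). TAKES NO SIDE on [IUTchIII] Cor. 3.12 or on any author.

THE POINT. The per-`l` proofs at `13/17/19` used the lower local type `3l ∣ e` over `23` (exact `l` + Tate root `t = 5`), which does NOT reach the depth
need `5(l−3)/(2l) − 2/(l+1)` for larger `l`. abc-iut-w4-d107's UNCONDITIONAL TWIST factor (p481677, `GenuineK.two_dvd_ramificationIdx_F_of_odd_pole`: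
`ord_p λ < 0` odd, `j(λ) ≠ 1728` ⟹ `2 ∣ e(w | p)` at every place `w` of `T.F`) is PLACE-LEVEL on `F`, so it holds under the M-line members too:
`ord₂₃(2/23⁵) = −5` is odd, hence
* §1 **`ReyssatM.six_mul_dvd_absRamificationIdx_kOfM_twentyThree`** — `6·l ∣ e(K_{v̲(x₀)}/ℚ₂₃)` at EVERY M member over `23` (`l ≠ 23`): `e = e(w_F|23)·l`
  (abc-iut-W-num-6's `GenuineM.absRamificationIdx_kOfM_eq_mul_prime_ratPoint`, p480786), `3 ∣ e(w_F|23)` (its `three_mul_prime_dvd…`, `t = 5`),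
  `2 ∣ e(w_F|23)` (p481677 at `w_F = finBelow T.F T.K (placeOfM x₀)`). This is the `e_w = 6l` the R-W numerics (M-SHALLOW-INPUTS.tsv 45a0a9129e6618d8)
  ASSUMED at `23` — now a theorem of the typed datum.
* §3 **`ReyssatM.not_exists_deep`** — for `l ≤ 19 ∨ 85 ≤ l`, `l ≠ 109`, and EVERY `T : Cor22.ThetaVolumeDatumAt (ratPoint (2/23⁵)) l` (so `l` prime `≥ 5`):
  the member type of the `hshallow` binder of abc-iut-C-cert-3's M apex socket `not_hSHwBad_M_of_refuted` (p468391 §1) VERBATIM — no `(u, i, x₀)` is M-deep.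
  Per member: good ⇒ `‖t_q‖ = 1`; bad ⇒ over `p ∈ {3, 23, 109}`, `‖t_{q,x₀}‖ = p^{−h_p/(2l)}`, `h = 20, 10, 2` (abc-iut-w5-d166's `norm_tqM_eq_rpow_ord_rat`);
  the label arithmetic is `ReyssatM.expo_nonneg_div` (endpoint form, `N = (l−3)/2`): over `3`, `3l ∣ e` and `ReyssatM.depthConstants_ge_three` (`k = 3` for
  `l ≥ 6`, `k = 2` at `l = 5`) give `X ≥ 5 − 2/(3l) ≥ 5 − 15/l`; over `23`, `6l ∣ e`: for `l ≥ 85` (`6l ≥ 506 = 23·22`, upper-radius window `k = 2`)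
  `X ≥ 3 − 1/(6l) > 5/2`, for `l ≤ 19` (`l ∈ {5,7,11,13,17,19}`, `ReyssatM.prime_le_nineteen`) `X ≥ 2 + 1/21 − 1/(3l)` against `5(l−3)/(2l) − 2/(l+1)` =
  `0.667 | 1.179 | 1.652 | 1.780 | 1.948 | 2.005` numerically each; over `109` (`l ≠ 109`), `l ∣ e` gives `X ≥ 1 − 1/l ≥ 1/2 − 3/(2l) + …`.
  HONEST GAP (numbers, not adjectives): for the primes `29 ≤ l ≤ 83` NOTHING is claimed — there `6l < 506` and the bound `2 + 1/21 − 1/(3l)` is BELOW the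
  need (e.g. `l = 29`: `2.036 < 2.175`); if `e(w_F | 23) = 6` is realised, the top label over `23` IS M-deep at those `l` (so `hshallow` would be FALSE there).
  Of the 15 tabulated Reyssat M rows, the 14 with `l ∈ {13, 17, 19, 89, 97, 101, 103, 107, 113, 127, 131, 137, 139, 149}` are covered by this ONE theorem;
  the row `l = 109` (`= p`) is NOT (the `p ≠ l` local-type lemmas do not apply over `109`) and keeps its per-datum status.
HONEST FRAMING: statements about OUR sharp M setting's explicit `(d, a, b)` depth form at one rational datum; «refuted as typed» ≠ «refuted in print»;
nothing here asserts that abc is proved or refuted, or that [IUTchIII] Cor. 3.12 / Thm. 3.11 or [IUTchIV] Thm. 1.10 holds or fails; typed ≠ proved;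
instantiated ≠ endorsed; NO abc claim. [claim: Mochizuki2012, status: disputed] for every IUT sentence quoted. [cite: Mochizuki2012, IUTchI Ex. 3.2 (iv)
p. 71; IUTchIII Cor. 3.12 Step (xi-f) p. 184; IUTchIV Prop. 1.2 (i)(ii) p. 10, Thm. 1.10 p. 22, Cor. 2.2 (ii) proof (P5) p. 46]
[cite: SilvermanAEC2009, Prop. III.1.7(b), Prop. VII.5.1(b)] [cite: SilvermanATAEC1994, V.5 Thm. 5.3 and Cor. 5.4] [cite: SerreLocalFields1979, Ch. III §6 Prop. 13]
[cite: DupuyHilado2025, §3.3, §3.4]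
-/

noncomputable section

open Set Function NumberField IsDedekindDomain

namespace Summit.ABC.IUTFork.Conditional

open Thm311 Thm311.Real Cor312 Cor312Vol Cor312Prov Literature.IUT.LogThetaLattice Literature.IUT.LogVolume
  Literature.IUT.HodgeTheaters Literature.IUT.LogVolume.ThetaData Literature.IUT.LogVolume.Cor22
open Literature.NumberTheory.NumberFields Literature.NumberTheory.GaloisRepresentations.Ultrametric
open Literature.NumberTheory.DiophantineGeometry Literature.NumberTheory.DiophantineGeometry.GenEll Summit.ABC.ABC.Theorems
open scoped Classical

/-! ## §1. The Reyssat datum at `23`: `ord₂₃ λ = −5` (odd), `j(λ) ≠ 1728`, hence `6·l ∣ e(K_{v̲(x₀)}/ℚ₂₃)` at every M member -/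

/-- **`ord_v (2/23⁵) = −5`** at the place `v` of `ℚ` over `23`. [folklore] -/
theorem ReyssatM.ord_lambda_twentyThree (v : HeightOneSpectrum (𝓞 ℚ)) (hv : Rat.HeightOneSpectrum.natGenerator v = 23) :
    Literature.IUT.LogVolume.ord ℚ v (((2 : ℕ) : ℚ) / ((23 ^ 5 : ℕ) : ℚ)) = -((5 : ℕ) : ℤ) := by
  have h2 : ((2 : ℕ) : ℚ) ≠ 0 := by norm_num
  have h23 : (((23 ^ 5 : ℕ)) : ℚ) ≠ 0 := by norm_num
  rw [div_eq_mul_inv, ord_mul ℚ v h2 (inv_ne_zero h23), ord_inv, Cor22.ord_natCast_eq_factorization v (by norm_num),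
    Cor22.ord_natCast_eq_factorization v (by norm_num), hv, Nat.factorization_eq_zero_of_not_dvd (by norm_num),
    Nat.factorization_pow]
  simp [(by norm_num : Nat.Prime 23).factorization_self]

/-- **`j(2/23⁵) ≠ 1728`** (abc-iut-C-cert-3's `ReyssatM.jInv_eq`). [cite: SilvermanAEC2009, Prop. III.1.7(b)] -/
theorem ReyssatM.jInv_ne_1728 : Cor22.jInv (((2 : ℕ) : ℚ) / (23 ^ 5 : ℕ)) ≠ 1728 := by
  rw [ReyssatM.jInv_eq]; norm_num

/-- **`6·l ∣ e(K_{v̲(x₀)}/ℚ₂₃)` at EVERY M member over `23` of every genuine datum over `(2/23⁵, l)`, `l ≠ 23`.** The exact `l` and the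
Tate root `3` (`t = 5`; abc-iut-W-num-6's `GenuineM.three_mul_prime_dvd_absRamificationIdx_kOfM_ratPoint` /
`GenuineM.absRamificationIdx_kOfM_eq_mul_prime_ratPoint`, p480786) AND the UNCONDITIONAL TWIST factor `2` of abc-iut-w4-d107's
`GenuineK.two_dvd_ramificationIdx_F_of_odd_pole` (p481677: `ord₂₃ λ = −5` is odd, `j(λ) ≠ 1728`, so `2 ∣ e(w | 23)` at every place `w` of `T.F`) —
read at the place of `F` under the member. This is the `e_w = 6l` the R-W numerics assumed at `23`, now a theorem of the typed datum.
[cite: Mochizuki2012, IUTchI Ex. 3.2 (iv) p. 71; IUTchIV Thm. 1.10 p. 22] [cite: SilvermanAEC2009, Prop. VII.5.1(b)] [cite: SilvermanATAEC1994, V.5 Thm. 5.3]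
[claim: Mochizuki2012, status: disputed] -/
theorem ReyssatM.six_mul_dvd_absRamificationIdx_kOfM_twentyThree {l : ℕ} (T : Cor22.ThetaVolumeDatumAt (ratPoint (((2 : ℕ) : ℚ) / (23 ^ 5 : ℕ))) l)
    (hl23 : l ≠ 23) (u : FinitePlace ℚ) (hu : ratChar u = 23) :
    letI := T.instFieldF; letI := T.instNumberFieldF; letI := T.instAlgebraF; letI := T.instFieldK
    letI := T.instNumberFieldK; letI := T.instAlgebraK; letI := T.instFieldFbar; letI := T.instAlgebraFbar
    letI := T.instAlgebraKFbar; letI := T.instIsElliptic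
    ∀ x₀ : (thetaIndexOfInitial T.D).Fibre (Val.non u),
      6 * l ∣ absRamificationIdx (ratChar u) (kOfM T.D (ratChar u) u (natCast_ratChar_mem u) x₀) := by
  letI := T.instFieldF; letI := T.instNumberFieldF; letI := T.instAlgebraF; letI := T.instFieldK
  letI := T.instNumberFieldK; letI := T.instAlgebraK; letI := T.instFieldFbar; letI := T.instAlgebraFbar
  letI := T.instAlgebraKFbar; letI := T.instIsElliptic
  intro x₀
  have hp2 : ratChar u ≠ 2 := by rw [hu]; norm_num
  have hpl : ratChar u ≠ l := by rw [hu]; exact fun h => hl23 h.symm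
  have hpole : ∀ w : HeightOneSpectrum (𝓞 ℚ), Rat.HeightOneSpectrum.natGenerator w = ratChar u →
      Literature.IUT.LogVolume.ord ℚ w (Cor22.jInv (((2 : ℕ) : ℚ) / ((23 ^ 5 : ℕ) : ℚ))) = -(2 * ((5 : ℕ) : ℤ)) := fun w hw => by
    rw [ReyssatM.ord_jInv_of_mem w (by rw [hw, hu]; decide), hw, hu]; norm_num
  have hpole' : ∀ w : HeightOneSpectrum (𝓞 ℚ), Rat.HeightOneSpectrum.natGenerator w = ratChar u →
      Literature.IUT.LogVolume.ord ℚ w (Cor22.jInv (((2 : ℕ) : ℚ) / ((23 ^ 5 : ℕ) : ℚ))) < 0 := fun w hw => by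
    rw [hpole w hw]; norm_num
  -- `3·l ∣ e` (Tate root, `t = 5`) and `e = e(w_F | 23)·l`
  have h3l : 3 * l ∣ absRamificationIdx (ratChar u) (kOfM T.D (ratChar u) u (natCast_ratChar_mem u) x₀) :=
    GenuineM.three_mul_prime_dvd_absRamificationIdx_kOfM_ratPoint T u hp2 hpl (t := 5) (by norm_num) (by norm_num) hpole x₀
  have heq := GenuineM.absRamificationIdx_kOfM_eq_mul_prime_ratPoint T u hp2 hpl hpole' x₀
  -- `2 ∣ e(w_F | 23)` by the unconditional twist factor
  set wF := finBelow T.F T.K (placeOfM T.D u x₀) with hwFdef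
  have hwF : (((⟨23, by norm_num⟩ : Nat.Primes) : ℕ) : 𝓞 T.F) ∈ wF.asIdeal := by
    change ((23 : ℕ) : 𝓞 T.F) ∈ Ideal.comap (algebraMap (𝓞 T.F) (𝓞 T.K)) (placeOfM T.D u x₀).asIdeal
    rw [Ideal.mem_comap, map_natCast]
    have h := natCast_mem_placeOfM T.D (ratChar u) u (natCast_ratChar_mem u) x₀
    rwa [hu] at h
  have h2F : 2 ∣ wF.asIdeal.ramificationIdx ℤ :=
    GenuineK.two_dvd_ramificationIdx_F_of_odd_pole T ReyssatM.jInv_ne_1728 ⟨23, by norm_num⟩ (by norm_num) (t := 5) ⟨2, rfl⟩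
      (fun v hv => ReyssatM.ord_lambda_twentyThree v hv) wF hwF
  -- combine: `e = e_F·l` with `2 ∣ e_F` and `3·l ∣ e_F·l`
  rw [heq] at h3l ⊢
  have hl0 : 0 < l := T.D.l_prime.pos
  have h3F : 3 ∣ wF.asIdeal.ramificationIdx ℤ := by
    have h := Nat.dvd_of_mul_dvd_mul_right hl0 (by simpa [mul_comm] using h3l)
    exact h
  have h6F : 6 ∣ wF.asIdeal.ramificationIdx ℤ := by
    have hcop : Nat.Coprime 2 3 := by decide
    simpa using hcop.mul_dvd_of_dvd_of_dvd h2F h3F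
  exact mul_dvd_mul h6F dvd_rfl

/-! ## §2. Small arithmetic -/

/-- The primes `5 ≤ l ≤ 19`. [folklore] -/
theorem ReyssatM.prime_le_nineteen {l : ℕ} (hp : l.Prime) (h5 : 5 ≤ l) (h19 : l ≤ 19) :
    l = 5 ∨ l = 7 ∨ l = 11 ∨ l = 13 ∨ l = 17 ∨ l = 19 := by
  interval_cases l <;> first | (exfalso; revert hp; decide) | simp

/-- **The label arithmetic in the shape the goal takes after the norm rewrite** (`h = −ord_p j ≥ 0`, `L = l > 0`, `N = l⋆ − 1`):
`h/(2L)·N − 1/(N+2) ≤ X ⟹ 0 ≤ (i+2)X + 1 + (−h)/(2L)·(i(i+2))` for `0 ≤ i ≤ N` (`ReyssatM.expo_nonneg_of_le`). [cite: Mochizuki2012, IUTchIV Thm. 1.10 Step (v) p. 27–28] -/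
theorem ReyssatM.expo_nonneg_div {X i N h L : ℝ} (hL : 0 < L) (hh : 0 ≤ h) (hi0 : 0 ≤ i) (hiN : i ≤ N)
    (hX : h / (2 * L) * N - 1 / (N + 2) ≤ X) :
    0 ≤ (i + 2) * X + 1 + (-h) / (2 * L) * (i * (i + 2)) := by
  have key := ReyssatM.expo_nonneg_of_le (μ := h / (2 * L)) hi0 hiN (by positivity) hX
  have e : (-h) / (2 * L) * (i * (i + 2)) = -(h / (2 * L)) * (i * (i + 2)) := by ring
  linarith

/-! ## §3. The UNIFORM M-shallowness theorem at the Reyssat datum -/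

/-- **UNIFORM M-SHALLOWNESS AT THE REYSSAT DATUM.** For `l ≤ 19 ∨ 85 ≤ l`, `l ≠ 109`, and EVERY genuine Θ-volume datum `T` over
`(ratPoint (2/23⁵), l)`: NO finite place `u` of `ℚ`, label `i + 1 ≤ l⋆` and member `x₀ ∈ V̲_u` of the M-fibre satisfy
`p_u^{((i+2)(d+a+b)+1)}·‖t_{q,x₀}‖^{(i+1)²−1} < 1` — the member type of the `hshallow` binder of `not_hSHwBad_M_of_refuted` (p468391 §1) VERBATIM.
Ingredients BY NAME: `norm_tqM_eq_one_of_not_mem` / `norm_tqM_eq_rpow_ord_rat` (abc-iut-w5-d166), `ReyssatM.ord_jInv_of_mem/_nonneg_of_not_mem`,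
`ReyssatM.depthConstants_ge/_ge_three`, `ReyssatM.logRadiusB_ge_of_pow_le` (abc-iut-C-cert-3), `GenuineM.three_mul_prime_dvd_/prime_dvd_absRamificationIdx_kOfM_ratPoint`
(abc-iut-W-num-6), §1's `six_mul_dvd…` (twist factor, abc-iut-w4-d107), `ReyssatM.one_div_sub_two_le_logRadiusA` / `expo_nonneg_of_le` (this seat, p484988).
Nothing is claimed for `29 ≤ l ≤ 83` (see the file header). [cite: Mochizuki2012, IUTchI Ex. 3.2 (iv) p. 71; IUTchIV Prop. 1.2 (i)(ii) p. 10, Cor. 2.2 (ii)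
proof (P5) p. 46] [cite: DupuyHilado2025, §3.3, §3.4] [cite: SerreLocalFields1979, Ch. III §6 Prop. 13] [claim: Mochizuki2012, status: disputed] -/
theorem ReyssatM.not_exists_deep {l : ℕ} (hl : l ≤ 19 ∨ 85 ≤ l) (hl109 : l ≠ 109)
    (T : Cor22.ThetaVolumeDatumAt (ratPoint (((2 : ℕ) : ℚ) / (23 ^ 5 : ℕ))) l) :
    letI := T.instFieldF; letI := T.instNumberFieldF; letI := T.instAlgebraF; letI := T.instFieldK
    letI := T.instNumberFieldK; letI := T.instAlgebraK; letI := T.instFieldFbar; letI := T.instAlgebraFbar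
    letI := T.instAlgebraKFbar; letI := T.instIsElliptic
    ¬ (∃ (u : FinitePlace ℚ) (i : Fin (thetaIndexOfInitial T.D).lstar) (x₀ : (thetaIndexOfInitial T.D).Fibre (Val.non u)),
      ((ratChar u : ℕ) : ℝ) ^ ((((i : ℕ) : ℝ) + 2) *
      (differentOrd (ratChar u) (kOfM T.D (ratChar u) u (natCast_ratChar_mem u) x₀)
      + logRadiusA (ratChar u) (absRamificationIdx (ratChar u) (kOfM T.D (ratChar u) u (natCast_ratChar_mem u) x₀))
      + logRadiusB (ratChar u) (absRamificationIdx (ratChar u) (kOfM T.D (ratChar u) u (natCast_ratChar_mem u) x₀))) + 1) *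
      ‖tqM T.D (ratChar u) u (natCast_ratChar_mem u) (ideleDataOf T.D T.isVolumeInputOf) x₀‖ ^ (((i : ℕ) + 1) ^ 2 - 1) < 1) := by
  letI := T.instFieldF; letI := T.instNumberFieldF; letI := T.instAlgebraF; letI := T.instFieldK
  letI := T.instNumberFieldK; letI := T.instAlgebraK; letI := T.instFieldFbar; letI := T.instAlgebraFbar
  letI := T.instAlgebraKFbar; letI := T.instIsElliptic
  rintro ⟨u, i, x₀, hlt⟩
  haveI hpfact : Fact (ratChar u).Prime := inferInstance
  have hp1 : (1 : ℝ) < ((ratChar u : ℕ) : ℝ) := by exact_mod_cast hpfact.out.one_lt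
  have hp0 : (0 : ℝ) < ((ratChar u : ℕ) : ℝ) := lt_trans zero_lt_one hp1
  have hlp : l.Prime := T.D.l_prime
  have hl5 : 5 ≤ l := T.D.five_le_l
  have hl0 : (0 : ℝ) < (l : ℝ) := by exact_mod_cast (show 0 < l by omega)
  have hl5R : (5 : ℝ) ≤ (l : ℝ) := by exact_mod_cast hl5
  set K₀ := kOfM T.D (ratChar u) u (natCast_ratChar_mem u) x₀ with hK₀def
  set e : ℕ := absRamificationIdx (ratChar u) K₀ with hedef
  set X : ℝ := differentOrd (ratChar u) K₀ + logRadiusA (ratChar u) e + logRadiusB (ratChar u) e with hXdef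
  have he1 : 1 ≤ e := absRamificationIdx_pos (ratChar u) K₀
  have he0 : (0 : ℝ) < (e : ℝ) := by exact_mod_cast he1
  have hdab : 0 ≤ X := GenuineMShrink2.depthConstants_nonneg (ratChar u) K₀
  -- the label: `i ≤ N = (l − 3)/2`
  have hlstar : (thetaIndexOfInitial T.D).lstar = (l - 1) / 2 := rfl
  have hiN : 2 * (i : ℕ) + 3 ≤ l := by
    have h1 : (i : ℕ) < (thetaIndexOfInitial T.D).lstar := i.2
    have hodd : l % 2 = 1 := by
      rcases hlp.eq_two_or_odd with h | h
      · omega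
      · exact h
    omega
  have hiNR : ((i : ℕ) : ℝ) ≤ ((l : ℝ) - 3) / 2 := by
    rw [le_div_iff₀ (by norm_num : (0 : ℝ) < 2)]
    have : (((2 * (i : ℕ) + 3 : ℕ)) : ℝ) ≤ (l : ℝ) := by exact_mod_cast hiN
    push_cast at this
    linarith
  have hi0 : (0 : ℝ) ≤ ((i : ℕ) : ℝ) := Nat.cast_nonneg _
  have hN2 : (0 : ℝ) < ((l : ℝ) - 3) / 2 + 2 := by linarith
  have hN2' : 0 ≤ 1 / (((l : ℝ) - 3) / 2 + 2) := by positivity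
  have hB : ((((i : ℕ) + 1) ^ 2 - 1 : ℕ) : ℝ) = ((i : ℕ) : ℝ) * (((i : ℕ) : ℝ) + 2) := by
    have : 1 ≤ ((i : ℕ) + 1) ^ 2 := Nat.one_le_pow _ _ (by omega)
    push_cast [Nat.cast_sub this]
    ring
  by_cases hS : placeModOfM T.D u x₀ ∈ (ThetaData.pilotData T.D).S
  · -- a BAD member: `p ∈ {3, 23, 109}` and `‖t_{q,x₀}‖ = p^{ord_p j(2/23⁵)/(2l)}`
    set v : HeightOneSpectrum (𝓞 ℚ) := finBelow ℚ (fieldOfModuli T.E) (placeModOfM T.D u x₀) with hvdef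
    have hgen : Rat.HeightOneSpectrum.natGenerator v = ratChar u :=
      natGenerator_finBelow_placeModOfM T.D (ratChar u) u (natCast_ratChar_mem u) x₀
    have hjF : T.E.j = (((Cor22.jInv (((2 : ℕ) : ℚ) / (23 ^ 5 : ℕ)) : ℚ)) : T.F) := by rw [T.j_eq]; exact eq_ratCast _ _
    have hnorm := norm_tqM_eq_rpow_ord_rat T.D (ratChar u) u (natCast_ratChar_mem u) (ideleDataOf T.D T.isVolumeInputOf) x₀ hS
      (Cor22.jInv (((2 : ℕ) : ℚ) / (23 ^ 5 : ℕ))) hjF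
    have hneg : Literature.IUT.LogVolume.ord ℚ v (Cor22.jInv (((2 : ℕ) : ℚ) / ((23 ^ 5 : ℕ) : ℚ))) < 0 := by
      have h := (ThetaData.pilotData T.D).ord_jE_neg _ hS
      rw [ThetaData.pilotData_jE, jMod_eq_algebraMap_of_j_eq (E := T.E) _ hjF] at h
      exact (Cor22.ord_algebraMap_neg_iff _ _).mp h
    have hmem : Rat.HeightOneSpectrum.natGenerator v ∈ ({3, 23, 109} : Finset ℕ) := by
      by_contra hnot
      exact absurd (ReyssatM.ord_jInv_nonneg_of_not_mem v hnot) (not_le.mpr hneg)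
    have hord := ReyssatM.ord_jInv_of_mem v hmem
    rw [hgen] at hord hmem
    rw [hnorm, ← Real.rpow_natCast, ← Real.rpow_mul hp0.le, ← Real.rpow_add hp0, hB] at hlt
    refine absurd hlt (not_lt.mpr (Real.one_le_rpow hp1.le ?_))
    simp only [Finset.mem_insert, Finset.mem_singleton] at hmem
    rcases hmem with hpu | hpu | hpu
    · -- over `3`: `h = 20`, `3l ∣ e`, `X ≥ 2 + k − 2/(3l)` with `k = 3` (`l ≥ 7`) or `k = 2` (`l = 5`); need `5 − 15/l − 1/(N+2)`
      have hl3 : ratChar u ≠ l := by rw [hpu]; omega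
      have h3l : 3 * l ∣ e := GenuineM.three_mul_prime_dvd_absRamificationIdx_kOfM_ratPoint T u (by rw [hpu]; norm_num) hl3
        (t := 10) (by norm_num) (by norm_num)
        (fun w hw => by rw [ReyssatM.ord_jInv_of_mem w (by rw [hw, hpu]; decide), hw, hpu]; norm_num) x₀
      have hle : 3 * l ≤ e := Nat.le_of_dvd he1 h3l
      have hordv : ((Literature.IUT.LogVolume.ord ℚ v (Cor22.jInv (((2 : ℕ) : ℚ) / ((23 ^ 5 : ℕ) : ℚ))) : ℤ) : ℝ) = -20 := by
        rw [hord, hpu]; norm_num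
      rw [hordv]
      refine ReyssatM.expo_nonneg_div (X := X) (i := ((i : ℕ) : ℝ)) (N := ((l : ℝ) - 3) / 2) hl0 (by norm_num) hi0 hiNR ?_
      have h1 : (20 : ℝ) / (2 * l) * (((l : ℝ) - 3) / 2) = 5 - 15 / l := by field_simp; try ring
      have h2 : (15 : ℝ) / l ≥ 2 / ((3 * l : ℕ) : ℝ) := by
        push_cast
        rw [ge_iff_le, div_le_div_iff₀ (by positivity) hl0]
        nlinarith
      rw [h1]
      rcases (show l = 5 ∨ 6 ≤ l by omega) with rfl | hl6
      · -- `l = 5`: `k = 2`, `X ≥ 4 − 2/15`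
        have hX : (2 : ℝ) + (2 : ℕ) - 2 / ((3 * 5 : ℕ) : ℝ) ≤ X :=
          ReyssatM.depthConstants_ge_three (ratChar u) K₀ hpu (e₀ := 3 * 5) (k := 2) (by omega) hle (by omega)
        norm_num at hX ⊢
        linarith
      · -- `l ≥ 6`: `k = 3`, `X ≥ 5 − 2/(3l)`
        have hX : (2 : ℝ) + (3 : ℕ) - 2 / ((3 * l : ℕ) : ℝ) ≤ X :=
          ReyssatM.depthConstants_ge_three (ratChar u) K₀ hpu (e₀ := 3 * l) (k := 3) (by omega) hle (by omega)
        push_cast at hX h2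
        linarith
    · -- over `23`: `h = 10`, `6l ∣ e`
      have hl23 : l ≠ 23 := by rcases hl with h | h <;> omega
      have h6l := ReyssatM.six_mul_dvd_absRamificationIdx_kOfM_twentyThree T hl23 u hpu x₀
      have hle : 6 * l ≤ e := Nat.le_of_dvd he1 h6l
      have hleR : ((6 * l : ℕ) : ℝ) ≤ e := by exact_mod_cast hle
      have h6l0 : (0 : ℝ) < ((6 * l : ℕ) : ℝ) := by exact_mod_cast (show 0 < 6 * l by omega)
      have hinv : 1 / (e : ℝ) ≤ 1 / ((6 * l : ℕ) : ℝ) := one_div_le_one_div_of_le h6l0 hleR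
      have hordv : ((Literature.IUT.LogVolume.ord ℚ v (Cor22.jInv (((2 : ℕ) : ℚ) / ((23 ^ 5 : ℕ) : ℚ))) : ℤ) : ℝ) = -10 := by
        rw [hord, hpu]; norm_num
      rw [hordv]
      refine ReyssatM.expo_nonneg_div (X := X) (i := ((i : ℕ) : ℝ)) (N := ((l : ℝ) - 3) / 2) hl0 (by norm_num) hi0 hiNR ?_
      have h1 : (10 : ℝ) / (2 * l) * (((l : ℝ) - 3) / 2) = 5 / 2 - 15 / (2 * l) := by field_simp; try ring
      rw [h1]
      rcases hl with hle19 | hge85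
      · -- `l ≤ 19`: `e ≥ 6l`, `d ≥ 1 − 1/e`, `a ≥ 1/21`, `b ≥ 1 − 1/e`
        have hd : ((e : ℝ) - 1) / e ≤ differentOrd (ratChar u) K₀ := sub_one_div_le_differentOrd (ratChar u) K₀
        have hd' : 1 - 1 / (e : ℝ) ≤ differentOrd (ratChar u) K₀ := by rw [sub_div, div_self he0.ne'] at hd; exact hd
        have ha : (1 : ℝ) / 21 ≤ logRadiusA (ratChar u) e := by
          rw [hpu]
          have h := ReyssatM.one_div_sub_two_le_logRadiusA (p := 23) (e := e) (by norm_num) he1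
          norm_num at h ⊢
          exact h
        have hb : ((1 : ℕ) : ℝ) - 1 / e ≤ logRadiusB (ratChar u) e :=
          ReyssatM.logRadiusB_ge_of_pow_le hpfact.out.one_lt he1 (by rw [hpu]; omega)
        have hX : (2 : ℝ) + 1 / 21 - 2 * (1 / ((6 * l : ℕ) : ℝ)) ≤ X := by push_cast at hb hinv ⊢; linarith
        rcases ReyssatM.prime_le_nineteen hlp hl5 hle19 with rfl | rfl | rfl | rfl | rfl | rfl <;>
          · norm_num at hX ⊢; linarith
      · -- `85 ≤ l`: `e ≥ 6l ≥ 510 ≥ 23·22`, so `b ≥ 2 − 1/e` and `X ≥ 3 − 1/(6l) > 5/2`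
        have hX : (1 : ℝ) + (2 : ℕ) - 1 / ((6 * l : ℕ) : ℝ) ≤ X :=
          ReyssatM.depthConstants_ge (ratChar u) K₀ (e₀ := 6 * l) (k := 2) (by omega) hle (by rw [hpu]; omega)
        have h85 : (85 : ℝ) ≤ l := by exact_mod_cast hge85
        have h2 : 1 / ((6 * l : ℕ) : ℝ) ≤ 1 / 510 := by
          rw [div_le_div_iff₀ h6l0 (by norm_num)]; push_cast; linarith
        have h3 : 0 ≤ (15 : ℝ) / (2 * l) := by positivity
        push_cast at hX h2
        linarith
    · -- over `109`: `h = 2`, `l ∣ e`, `X ≥ 1 − 1/l`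
      have hpl : ratChar u ≠ l := by rw [hpu]; exact fun h => hl109 h.symm
      have hld : l ∣ e := GenuineM.prime_dvd_absRamificationIdx_kOfM_ratPoint T u (by rw [hpu]; norm_num) hpl
        (fun w hw => by rw [ReyssatM.ord_jInv_of_mem w (by rw [hw, hpu]; decide), hw, hpu]; norm_num) x₀
      have hle : l ≤ e := Nat.le_of_dvd he1 hld
      have hX : (1 : ℝ) + (0 : ℕ) - 1 / (l : ℝ) ≤ X :=
        ReyssatM.depthConstants_ge (ratChar u) K₀ (e₀ := l) (k := 0) (by omega) hle (by rw [hpu]; omega)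
      have hordv : ((Literature.IUT.LogVolume.ord ℚ v (Cor22.jInv (((2 : ℕ) : ℚ) / ((23 ^ 5 : ℕ) : ℚ))) : ℤ) : ℝ) = -2 := by
        rw [hord, hpu]; norm_num
      rw [hordv]
      refine ReyssatM.expo_nonneg_div (X := X) (i := ((i : ℕ) : ℝ)) (N := ((l : ℝ) - 3) / 2) hl0 (by norm_num) hi0 hiNR ?_
      have h1 : (2 : ℝ) / (2 * l) * (((l : ℝ) - 3) / 2) = 1 / 2 - 3 / (2 * l) := by field_simp; try ring
      have h2 : (1 : ℝ) / l ≤ 1 / 5 := one_div_le_one_div_of_le (by norm_num) hl5R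
      have h3 : 0 ≤ (3 : ℝ) / (2 * l) := by positivity
      push_cast at hX
      rw [h1]
      linarith
  · -- a GOOD member: the q-idele is a unit and the exponent is `≥ 1`
    rw [norm_tqM_eq_one_of_not_mem T.D (ratChar u) u (natCast_ratChar_mem u) (ideleDataOf T.D T.isVolumeInputOf) x₀ hS,
      one_pow, mul_one] at hlt
    have hi : (0 : ℝ) ≤ ((i : ℕ) : ℝ) + 2 := by positivity
    have hA : 0 ≤ (((i : ℕ) : ℝ) + 2) * X + 1 := by nlinarith [mul_nonneg hi hdab]
    exact absurd hlt (not_lt.mpr (Real.one_le_rpow hp1.le hA))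

end Summit.ABC.IUTFork.Conditional

end
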